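import Mathlib
import Summits.NavierStokesRegularity.NavierStokesRegularity.Theorems.QuasipotentialCoercivityEnstrophyToL3CoercivityEnergy
import Literature.Analysis.FluidPDE.SobolevWholeSpace
import Literature.Analysis.FluidPDE.EnstrophySplitting
import Literature.Analysis.FluidPDE.LerayHopfH1Test
import Summits.NavierStokesRegularity.NavierStokesRegularity.Theses.QuasipotentialCoercivity
import HarnessLib

/-!
# `QuasipotentialCoercivity.EnstrophyToL3Coercivity` — glue #3 ⇒ #2
  (item stmt-NavierStokesRegularity-1445)

**Statement.** If, for all `ν, τ > 0` and `a`, the states `x` reachable from rest by a classical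
forced Schwartz path of action `≤ a` followed by a free Leray–Hopf classical tail, within total time
`τ`, have uniformly bounded gradient energy `∫⁻ |∇x|²_F ≤ C`, then they have a uniform `L³` bound
`‖x‖_{L³} ≤ C'`.

PROOF. For a reachable `x = v(T₁)`: (1) energy is free — the forced piece satisfies
`∫⁻‖w(T₀)‖ₑ² ≤ 4T₀·a` (`EnstrophyToL3.lintegral_sq_le_action`: the energy identity of the forced path
holds with the UNCONTROLLED pressure because `∫⟨w, ∇q⟩ = 0` via `w = curl (biotSavart w)` and the
`L¹` divergence theorem), and the free tail does not increase energy (`IsLerayHopfOn.energy_ineq_zero`,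
`IsLerayHopfOn.eEnergy_eq`), so `∫⁻‖x‖ₑ² ≤ 4τ·a`; (2) Sobolev `‖x‖_{L⁶} ≤ K‖Dx‖_{L²}`
(`eLpNorm_six_le_eLpNorm_fderiv_two`, `‖Dx‖² ≤ |∇x|²_F`) gives `‖x‖₆ ≤ K C^{1/2}`; (3) Lebesgue
interpolation `∫|x|³ ≤ (∫|x|²)^{3/4}(∫|x|⁶)^{1/4}` (`lintegral_rpow_interpolate`).

HONEST FRAMING: routine function-space glue about hypothetical forced/free classical paths
(Gagliardo–Nirenberg–Sobolev on the reachable set); nothing here bears on Navier–Stokes regularity.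

## References
* J. C. Robinson, J. L. Rodrigo, W. Sadowski, *The Three-Dimensional Navier–Stokes Equations*,
  CUP (2016), Thm. 1.5 (Lebesgue interpolation), Lemma 3.3 (energy inequality). [RobinsonRodrigoSadowski2016]
* L. C. Evans, *Partial Differential Equations*, AMS (2010), §5.6.1. [Evans2010]
-/

noncomputable section

set_option linter.dupNamespace false

namespace Summit.NavierStokesRegularity.NavierStokesRegularity.Theorems

open Set MeasureTheory Filter Topology Function InnerProductSpace
open scoped ENNReal NNReal RealInnerProductSpace ContDiff Laplacian
open Literature.Analysis.FluidPDE

open EnstrophyToL3 in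
/-- **Glue #3 ⇒ #2 of route QuasipotentialCoercivity**: a uniform gradient-energy (enstrophy-type)
bound on the states reachable with action `≤ a` within time `τ` implies a uniform `L³` bound on
them. For a reachable `x = v(T₁)` (free Leray–Hopf tail `v` from `w(T₀)`, forced Schwartz piece `w`
from rest with `∫₀^{T₀}∫|g|² ≤ a`): energy is free — `∫|w(T₀)|² ≤ 4T₀·a`
(`EnstrophyToL3.lintegral_sq_le_action`; the energy identity of the forced path holds with the
UNCONTROLLED pressure because `∫⟨w, ∇q⟩ = 0` via `w = curl (biotSavart w)` and the `L¹` divergence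
theorem, `EnstrophyToL3.integral_inner_gradient_eq_zero₃`) and `∫|v(T₁)|² ≤ ∫|w(T₀)|²` (Leray–Hopf
energy inequality `IsLerayHopfOn.energy_ineq_zero`); then Sobolev `‖x‖₆ ≤ K‖Dx‖₂`
(`eLpNorm_six_le_eLpNorm_fderiv_two`, `‖Dx‖² ≤ |∇x|²_F`) and the Lebesgue interpolation
`∫|x|³ ≤ (∫|x|²)^{3/4} (∫|x|⁶)^{1/4}` (`lintegral_rpow_interpolate`). HONEST FRAMING: routine
function-space glue about hypothetical forced/free classical paths; nothing here bears on
Navier–Stokes regularity. [this file] -/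
theorem quasipotentialCoercivity_enstrophyToL3Coercivity_proof :
    Summit.NavierStokesRegularity.NavierStokesRegularity.Theses.QuasipotentialCoercivity.EnstrophyToL3Coercivity := by
  intro H ν hν τ hτ a
  obtain ⟨C₁, hC₁⟩ := H ν hν τ hτ a
  -- the uniform bound
  set K : ℝ≥0 := SNormLESNormFDerivOfEqConst (EuclideanSpace ℝ (Fin 3))
    (volume : Measure (EuclideanSpace ℝ (Fin 3))) 2 with hK
  set B₂ : ℝ≥0∞ := ENNReal.ofReal (4 * τ) * a with hB₂
  set B₆ : ℝ≥0∞ := ((K : ℝ≥0∞) * (C₁ : ℝ≥0∞) ^ (1 / 2 : ℝ)) ^ (6 : ℝ) with hB₆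
  set B : ℝ≥0∞ := (B₂ ^ (3 / 4 : ℝ) * B₆ ^ (1 / 4 : ℝ)) ^ (1 / 3 : ℝ) with hB
  have hB₂top : B₂ ≠ ⊤ := ENNReal.mul_ne_top ENNReal.ofReal_ne_top ENNReal.coe_ne_top
  have hB₆top : B₆ ≠ ⊤ :=
    ENNReal.rpow_ne_top_of_nonneg (by norm_num) (ENNReal.mul_ne_top ENNReal.coe_ne_top
      (ENNReal.rpow_ne_top_of_nonneg (by norm_num) ENNReal.coe_ne_top))
  have hBtop : B ≠ ⊤ :=
    ENNReal.rpow_ne_top_of_nonneg (by norm_num) (ENNReal.mul_ne_top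
      (ENNReal.rpow_ne_top_of_nonneg (by norm_num) hB₂top)
      (ENNReal.rpow_ne_top_of_nonneg (by norm_num) hB₆top))
  refine ⟨B.toNNReal, ?_⟩
  rintro x ⟨T₀, T₁, w, q, g, ⟨hT₀, hcl, hdec, hw0, hga⟩, hT₁, hsum, T₂, v, pv, hT₁₂, hclv, hLH, hv0,
    hvx⟩
  rw [ENNReal.coe_toNNReal hBtop]
  have hE : ∫⁻ y, ENNReal.ofReal (frobeniusNormSq (fderiv ℝ x y)) ≤ C₁ :=
    hC₁ x ⟨T₀, T₁, w, q, g, ⟨hT₀, hcl, hdec, hw0, hga⟩, hT₁, hsum, T₂, v, pv, hT₁₂, hclv, hLH, hv0,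
      hvx⟩
  have hT₁mem : T₁ ∈ Icc (0 : ℝ) T₂ := ⟨hT₁, hT₁₂.le⟩
  have hT₀τ : T₀ ≤ τ := by linarith
  -- the `L²` bound
  have hL2w : ∫⁻ y, ‖w T₀ y‖ₑ ^ 2 ≤ ENNReal.ofReal (4 * T₀) * a :=
    (lintegral_sq_le_action hν.le hT₀ hcl hdec hw0 T₀ ⟨hT₀.le, le_rfl⟩).trans
      (mul_le_mul_right hga _)
  obtain ⟨G, -, hEI⟩ := hLH.energy_ineq_zero
  have hKE : VectorCalculus.kineticEnergy (v T₁) ≤ VectorCalculus.kineticEnergy (w T₀) := by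
    have h := hEI T₁ hT₁mem
    have hz : ∫ τ' in (0 : ℝ)..T₁, ∫ y, ⟪(0 : ℝ → EuclideanSpace ℝ (Fin 3) → EuclideanSpace ℝ (Fin 3)) τ' y, v τ' y⟫ = 0 := by
      simp
    rw [hz, add_zero] at h
    have hν0 : 0 ≤ ν * (∫⁻ τ' in Ioo 0 T₁, ∫⁻ y, ENNReal.ofReal (frobeniusNormSq (G τ' y))).toReal :=
      mul_nonneg hν.le ENNReal.toReal_nonneg
    linarith
  have hL2x : ∫⁻ y, ‖x y‖ₑ ^ 2 ≤ B₂ := by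
    have e1 : eEnergy (v T₁) = ENNReal.ofReal (2 * VectorCalculus.kineticEnergy (v T₁)) :=
      hLH.eEnergy_eq hT₁mem
    have e0 : eEnergy (v 0) = ENNReal.ofReal (2 * VectorCalculus.kineticEnergy (v 0)) :=
      hLH.eEnergy_eq ⟨le_rfl, hT₁.trans hT₁₂.le⟩
    rw [← hvx]
    calc ∫⁻ y, ‖v T₁ y‖ₑ ^ 2 = eEnergy (v T₁) := rfl
      _ = ENNReal.ofReal (2 * VectorCalculus.kineticEnergy (v T₁)) := e1
      _ ≤ ENNReal.ofReal (2 * VectorCalculus.kineticEnergy (w T₀)) :=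
          ENNReal.ofReal_le_ofReal (by linarith)
      _ = eEnergy (v 0) := by rw [e0, hv0]
      _ = ∫⁻ y, ‖w T₀ y‖ₑ ^ 2 := by rw [hv0]; rfl
      _ ≤ ENNReal.ofReal (4 * T₀) * a := hL2w
      _ ≤ B₂ := by rw [hB₂]; gcongr
  -- regularity of `x`
  have hx1 : ContDiff ℝ 1 x := by
    rw [← hvx]
    exact (hclv.smooth_velocity.contDiff_slice (⟨hT₁, hT₁₂⟩ : T₁ ∈ Ico (0 : ℝ) T₂)).of_le
      (by norm_cast)
  have cx : Continuous x := hx1.continuous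
  have hx2 : eLpNorm x 2 volume < ⊤ := by
    rw [← hvx]; exact (hLH.memLp T₁ hT₁mem).eLpNorm_lt_top
  -- Sobolev and the gradient bound
  have hS : eLpNorm x 6 volume ≤ K * eLpNorm (fderiv ℝ x) 2 volume :=
    eLpNorm_six_le_eLpNorm_fderiv_two volume finrank_euclideanSpace_fin hx1 hx2
  have hD : eLpNorm (fderiv ℝ x) 2 volume ≤ (C₁ : ℝ≥0∞) ^ (1 / 2 : ℝ) := by
    rw [eLpNorm_eq_lintegral_rpow_enorm_toReal two_ne_zero ENNReal.ofNat_ne_top, ENNReal.toReal_ofNat]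
    refine ENNReal.rpow_le_rpow ?_ (by norm_num)
    calc ∫⁻ y, ‖fderiv ℝ x y‖ₑ ^ (2 : ℝ) = ∫⁻ y, ‖fderiv ℝ x y‖ₑ ^ 2 :=
          lintegral_congr fun y => by rw [ENNReal.rpow_two]
      _ ≤ ∫⁻ y, ENNReal.ofReal (frobeniusNormSq (fderiv ℝ x y)) :=
          lintegral_mono fun y => enorm_sq_fderiv_le_ofReal_frobeniusNormSq _
      _ ≤ C₁ := hE
  have h6 : ∫⁻ y, ‖x y‖ₑ ^ (6 : ℝ) ≤ B₆ := by
    have e6 : ∫⁻ y, ‖x y‖ₑ ^ (6 : ℝ) = eLpNorm x 6 volume ^ (6 : ℝ) := by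
      rw [eLpNorm_eq_lintegral_rpow_enorm_toReal (by norm_num) (by norm_num), ENNReal.toReal_ofNat,
        ← ENNReal.rpow_mul]
      norm_num
    rw [e6, hB₆]
    exact ENNReal.rpow_le_rpow (hS.trans (mul_le_mul_right hD _)) (by norm_num)
  have h2 : ∫⁻ y, ‖x y‖ₑ ^ (2 : ℝ) ≤ B₂ := by
    calc ∫⁻ y, ‖x y‖ₑ ^ (2 : ℝ) = ∫⁻ y, ‖x y‖ₑ ^ 2 := lintegral_congr fun y => by rw [ENNReal.rpow_two]
      _ ≤ B₂ := hL2x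
  -- interpolation `∫|x|³ ≤ (∫|x|²)^{3/4} (∫|x|⁶)^{1/4}`
  have hI : ∫⁻ y, ‖x y‖ₑ ^ (3 : ℝ) ≤
      (∫⁻ y, ‖x y‖ₑ ^ (2 : ℝ)) ^ ((6 - 3) / (6 - 2) : ℝ) * (∫⁻ y, ‖x y‖ₑ ^ (6 : ℝ)) ^ ((3 - 2) / (6 - 2) : ℝ) :=
    lintegral_rpow_interpolate cx.aemeasurable.enorm zero_lt_two (by norm_num) (by norm_num) (by norm_num)
  have e34 : ((6 - 3) / (6 - 2) : ℝ) = 3 / 4 := by norm_num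
  have e14 : ((3 - 2) / (6 - 2) : ℝ) = 1 / 4 := by norm_num
  rw [e34, e14] at hI
  have h3 : ∫⁻ y, ‖x y‖ₑ ^ (3 : ℝ) ≤ B₂ ^ (3 / 4 : ℝ) * B₆ ^ (1 / 4 : ℝ) :=
    hI.trans (mul_le_mul' (ENNReal.rpow_le_rpow h2 (by norm_num)) (ENNReal.rpow_le_rpow h6 (by norm_num)))
  have e3 : eLpNorm x 3 volume = (∫⁻ y, ‖x y‖ₑ ^ (3 : ℝ)) ^ (1 / 3 : ℝ) := by
    rw [eLpNorm_eq_lintegral_rpow_enorm_toReal (by norm_num) (by norm_num), ENNReal.toReal_ofNat]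
  rw [e3, hB]
  exact ENNReal.rpow_le_rpow h3 (by norm_num)

end Summit.NavierStokesRegularity.NavierStokesRegularity.Theorems
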